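import Literature.NumberTheory.LFunctions.Zhang2022.DetectorDictFormCS
import Literature.NumberTheory.LFunctions.Zhang2022.RepairDetShift

/-!
# Zhang (2022) §18-margin repair rung, barrier extension (cell landau-siegel §E, row S-E-p6-3):
# the GLUED (two-sided legs) shift-detector families — `not_repairable_true_need` in the currency of the
# detector's glued main-term form, the PSD slot DISPLAYED

Y. Zhang, *Discrete mean estimates and the Landau–Siegel zero*, arXiv:2211.02515v1 (2022) [Zhang2022LandauSiegel] —
an unrefereed manuscript under adjudication. **WHAT THIS IS NOT: a claim about its Theorems 1–2, about Landau–Siegel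
zeros, about Parity, or about a repaired `Margin232`. The programme SEARCHES and TYPES; no claim about Landau–Siegel
zeros, Theorems 1–2 of arXiv:2211.02515 or a repaired Margin232 until a kernel theorem says so.**

## What is extended, and in which currency

Row 17 (`Repair.familyDetShift`, `RepairDetShift`) decides the sign-admissible three-shift detector
`𝔠*_b = −iΠ_jM(ρ+ib_jα)/M′(ρ)` against ONE-SIDED legs (`u(1) = f(1) = 0`, range (7.2) of Prop. 7.1, formula I). The
manuscript's own `H`-side is TWO-SIDED: `𝔥 = H₁ + Z·H̄₂` has the GLUED profile `𝔤 = g₁ + R̃g₂` on `[0,1]`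
(`Repair.gluedS θ`; `R̃v(y) = conj v(1−y)`, `RepairFormReflection`), `𝔤(1) = conj g₂(0) ≠ 0`, and its main term is ONE
Hermitian-type form in `𝔤` — (4.1), `Repair.C232S θ = mainTermForm(𝔤_θ)` window term included (`Repair.C232S_eq_form`).
The B-det intake (`RepairIntakeBdet`, item (u3)) left «two-sided / glued legs at general `b`» UNCOVERED (S-E-p6-3 gated);
un-gated by ls-barrier-plan g1 2026-08-27T02:54:15Z / booked 03:14:42Z on the cell's two-sided doubling identities
(ls-num-2 Id-5/Id-7, ls-barrier-num TWO-SIDED-CIRCLE, two lineages exact; ls-theory referee PASS 02:50:28Z).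

Since `R̃` is CONJUGATE-linear, the glued profile is not a complex-linear function of the pair `(g₁, g₂)`: Cauchy–Schwarz
must run on one Hermitian form in the glued profile `G`. The tree's object is the one-form dictionary
`Det.DictShift b G G′` (`DetectorDictForm`, ls-Bdet-typer-1): `= mainTermForm` identically at `b = (1,2,3)`
(`dictShift_std`), `= Det.FormDetGlued b g₁ g₂` on non-overlapping kinked sides (`GluedSides.dictShift_glued_eq_formDetGlued`),
`= Det.FormDet (shiftRecipe b)` on one-sided kinked profiles (`dictShift_eq_formDet`); its polar form `Det.DictShiftPolar`,
polarisation and Cauchy–Schwarz-along-a-line are `DetectorDictFormCS`. This file types TWO slots and TWO families: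

* slot **`Det.GluedFormPSD b`** `:= ∀ sides, Det.GluedSides u u′ v v′ → 0 ≤ Det.FormDetGlued b u u′ v v′` — the glued
  (formula I + formula-II block, no window) form PSD on NON-OVERLAPPING kinked sides; = the conclusion of the cell's
  two-sided kernel chain K1″/K2″/K3′/K6″ (`DetectorTwoSidedCompose`, ls-barrier-p5 g4; `DetectorTwoPointIdentity`,
  ls-barrier-num g3) for sign-admissible `b` — NOT asserted here except at `b = (1,2,3)` (`gluedFormPSD_std`); and slot
  `Det.DictShiftPSD b` (`DetectorDictFormCS`: `DictShift b ≥ 0` on ALL `H¹` profiles — overlap included; printed instance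
  `dictShiftPSD_std`). `DictShiftPSD b → GluedFormPSD b` (`DictShiftPSD.gluedFormPSD`).
* **`Repair.familyDetGluedSep`** (the booked row): designs `(b; t₁,t₂; g₁,g₂; f₁,f₂)` — detector `b` sign-admissible in the
  Part-III box, the `H`-side glued from kinked sides `g₁` (supported in `[0,t₁]`) and `g₂` (in `[0,t₂]`), the probe glued
  from sides `f₁, f₂` on the SAME split, `t₁ + t₂ ≤ 1` (no overlap after reflection: `Det.SidesAt`); verdict = slot
  `GluedFormPSD b` DISPLAYED `→ ¬ (𝔅ᵍ_b(g₁,g₂)·𝔅ᵍ_b(f₁,f₂) < ‖P^dict_b(g₁+R̃g₂, f₁+R̃f₂)‖²)`, `𝔅ᵍ_b = Det.FormDetGlued b`.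
  `not_repairable_detGluedSep` = Cauchy–Schwarz INSIDE the split class (closed under `G + cF = (g₁+cf₁) + R̃(g₂+c̄f₂)`:
  `Det.SidesAt.add_smul`, `Det.gluedProfile_add_smul`) via `Det.norm_sq_dictPolar_le_of_line`.
* **`Repair.familyDetGlued`** (the full (u3) class): designs `Repair.DetShiftDesign` REUSED `(b; G,G′; f,f′)` with `G`, `f`
  ANY `H¹` profiles on `[0,1]` — no apex condition, overlap allowed (the manuscript's own `𝔤_θ₀` overlaps on
  `[½, 0.504]`); verdict = slot `DictShiftPSD b` DISPLAYED `→ ¬ (DictShift_b(G)·DictShift_b(f) < ‖P^dict_b(G,f)‖²)`.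
* C2/C4 (faithfulness at the printed triple): at `b = (1,2,3)` both slots are theorems and `familyDetGlued`'s verdict on
  `H¹` legs is LITERALLY `familyH1`'s (`detGlued_std_verdict_iff`); on the GENUINE design legs `(𝔤_θ, f_θ) =
  (gluedS θ, tentT θ)` of every calculus-class `θ` (members for every admissible `b`: `inClass_gluedLeg`) it is LITERALLY
  row 1's `¬ (C₂₃₂S·C₂₃₃T < |𝔡+𝔡′|²)` (`detGlued_std_gluedLeg_verdict_iff`, `h232/h233/hsum_on_calc`) — i.e. this family
  at `(1,2,3)` re-derives `Repair.not_repairable_true_need_calc`. Row 17 embeds (`inClassGlued_of_inClass`,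
  `detGlued_verdict_of_oneSided`).

Coverage bookkeeping (ls-barrier-plan g1 03:14:42Z): both rows are THRESHOLD / intake-members rows until their slot is a
tree theorem for every sign-admissible `b` (`familyDetGluedSep`: K6″ Part 4; `familyDetGlued`: an `H¹`/overlap assembly
of Id-7); they enter `Rplusplus` only then. Currency line (C3(e)): the objects are the CELL's continued main-term calculus
(formula I weights `Det.shiftW`, glue pair `(W·n/b, −e^{iπΣb/2})` — derivation-by-consistency, reviewed as a DEFINITION;
equal to the printed forms at `(1,2,3)`); that they ARE the main terms of a detector-`b` cross mean is registry E-det-main /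
formula II at general `b` (open, not claimed). Nothing here is a statement about zeros. Elementary assembly; standard axioms.

References: Y. Zhang, arXiv:2211.02515v1 (2022), §2 (2.13), Lemma 2.3, (2.16)–(2.19), (2.27), Props. 2.4–2.6,
(2.32)–(2.33) [pp. 5–6, 10–11]; §4 (4.1); §7 Prop. 7.1, (7.2) [p. 44]; §8 (8.2); §10 (10.1); §12 (12.6)–(12.17);
Prop. 14.1; Lemma 15.1; §18 (18.1). [cite: Zhang2022LandauSiegel, §§2, 4, 7–8, 10, 12, 14–15, 18]
-/

noncomputable section

open Real Complex ComplexConjugate Set intervalIntegral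
open _root_.MeasureTheory

namespace Literature.NumberTheory.LFunctions.Zhang2022

namespace Det

open Repair

variable {b : Fin 3 → ℝ} {u u' v v' f₁ f₁' f₂ f₂' g₁ g₁' g₂ g₂' : ℝ → ℂ} {t₁ t₂ : ℝ}

/-! ### The two slots -/

/-- **E*-S (i), two-sided no-overlap shape — the GLUED form PSD on non-overlapping kinked sides:**
`0 ≤ FormDetGlued b u u′ v v′` whenever `Det.GluedSides u u′ v v′` (side supports `[0,t₁]`, `[0,t₂]`, `t₁ + t₂ ≤ 1`).
Bare `Prop`, the slot `Repair.familyDetGluedSep` displays; the target of the cell's two-sided kernel chain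
(`Det.formDetGlued_nonneg_of_signAdmissible`, K6″) for sign-admissible `b`; asserted here ONLY at `b = (1,2,3)`.
[cite: Zhang2022LandauSiegel, §8 (8.2); §12 (12.6)–(12.8); Prop 14.1; Lemma 15.1; §18 (18.1)] -/
def GluedFormPSD (b : Fin 3 → ℝ) : Prop :=
  ∀ u u' v v' : ℝ → ℂ, GluedSides u u' v v' → 0 ≤ FormDetGlued b u u' v v'

/-- The glued profile of two kinked sides is `H¹`. [cite: Zhang2022LandauSiegel, §2 (2.27); §12 (12.6)–(12.8)] -/
theorem isH1_gluedProfile (hu : KinkedProfile u u') (hv : KinkedProfile v v') :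
    IsH1OnUnitInterval (gluedProfile u v) (gluedDeriv u' v') :=
  hu.isH1.add_refl hv.isH1

/-- **`DictShiftPSD b → GluedFormPSD b`** (for triples with non-zero entries): on non-overlapping sides the glued form
IS the dictionary of the glued profile (`GluedSides.dictShift_glued_eq_formDetGlued`), an `H¹` profile.
[cite: Zhang2022LandauSiegel, §4 (4.1); §12 (12.6)–(12.8); §18 (18.1)] -/
theorem DictShiftPSD.gluedFormPSD (h : DictShiftPSD b) (hb : ∀ j, b j ≠ 0) : GluedFormPSD b :=
  fun _ _ _ _ hs => by
    rw [← hs.dictShift_glued_eq_formDetGlued hb]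
    exact h _ _ (isH1_gluedProfile hs.kinked₁ hs.kinked₂)

/-- Sign-admissible triples have non-zero entries. [cite: Zhang2022LandauSiegel, §2 Lemma 2.3, (2.13)] -/
theorem SignAdmissible.ne_zero (hb : SignAdmissible b) (j : Fin 3) : b j ≠ 0 := (hb.pos j).ne'

/-- **The printed instance of the glued slot is a theorem:** `GluedFormPSD (1,2,3)` — on non-overlapping sides
`FormDetGlued (1,2,3) (u,v) = mainTermForm(u + R̃v) ≥ 0` (`GluedSides.mainTermForm_glued_std`, `formDetGlued_std`,
`mainTermForm_nonneg_of_isH1`). [cite: Zhang2022LandauSiegel, §4 (4.1); §12 (12.12)–(12.17); §18 (18.1)] -/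
theorem gluedFormPSD_std : GluedFormPSD ![1, 2, 3] :=
  dictShiftPSD_std.gluedFormPSD (by intro j; fin_cases j <;> norm_num)

/-! ### Sides on a fixed split: a class closed under the glued linear combinations -/

/-- **Two kinked sides on the split `(t₁, t₂)`:** `u` and its companion vanish on `[t₁, ∞)`, `v` and its companion on
`[t₂, ∞)` (the data of `Det.GluedSides` with the split displayed, so that two designs on the SAME split can be combined).
[cite: Zhang2022LandauSiegel, §12 (12.6)–(12.8)] -/
def SidesAt (t₁ t₂ : ℝ) (u u' v v' : ℝ → ℂ) : Prop :=
  KinkedProfile u u' ∧ KinkedProfile v v' ∧ (∀ y, t₁ ≤ y → u y = 0 ∧ u' y = 0) ∧ (∀ y, t₂ ≤ y → v y = 0 ∧ v' y = 0)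

/-- A no-overlap split makes `SidesAt` sides `GluedSides`. [cite: Zhang2022LandauSiegel, §12 (12.6)–(12.8)] -/
theorem SidesAt.gluedSides (ht : 0 ≤ t₁ ∧ 0 ≤ t₂ ∧ t₁ + t₂ ≤ 1) (h : SidesAt t₁ t₂ u u' v v') :
    GluedSides u u' v v' :=
  ⟨h.1, h.2.1, t₁, t₂, ht.1, ht.2.1, ht.2.2, h.2.2.1, h.2.2.2⟩

/-- **The split class is closed under `(u,v) + (c·f₁, c̄·f₂)`** — the pair whose glued profile is `G + c·F`.
[cite: Zhang2022LandauSiegel, §12 (12.6)–(12.8)] -/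
theorem SidesAt.add_smul (h : SidesAt t₁ t₂ u u' v v') (hf : SidesAt t₁ t₂ f₁ f₁' f₂ f₂') (c : ℂ) :
    SidesAt t₁ t₂ (fun x => u x + c * f₁ x) (fun x => u' x + c * f₁' x)
      (fun x => v x + conj c * f₂ x) (fun x => v' x + conj c * f₂' x) := by
  refine ⟨h.1.add_smul hf.1 c, h.2.1.add_smul hf.2.1 (conj c), fun y hy => ?_, fun y hy => ?_⟩
  · obtain ⟨a1, a2⟩ := h.2.2.1 y hy
    obtain ⟨b1, b2⟩ := hf.2.2.1 y hy
    simp [a1, a2, b1, b2]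
  · obtain ⟨a1, a2⟩ := h.2.2.2 y hy
    obtain ⟨b1, b2⟩ := hf.2.2.2 y hy
    simp [a1, a2, b1, b2]

/-- **The glued profile is complex-linear along these pairs:** `(u + cf₁) + R̃(v + c̄f₂) = (u + R̃v) + c·(f₁ + R̃f₂)`.
[cite: Zhang2022LandauSiegel, §2 (2.27); §12 (12.6)–(12.8)] -/
theorem gluedProfile_add_smul (u v f₁ f₂ : ℝ → ℂ) (c : ℂ) :
    gluedProfile (fun x => u x + c * f₁ x) (fun x => v x + conj c * f₂ x)
      = fun x => gluedProfile u v x + c * gluedProfile f₁ f₂ x := by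
  funext x
  simp only [gluedProfile, reflProfile, map_add, map_mul, Complex.conj_conj]
  ring

/-- … and so is its derivative companion. [cite: Zhang2022LandauSiegel, §2 (2.27); §12 (12.6)–(12.8)] -/
theorem gluedDeriv_add_smul (u' v' f₁' f₂' : ℝ → ℂ) (c : ℂ) :
    gluedDeriv (fun x => u' x + c * f₁' x) (fun x => v' x + conj c * f₂' x)
      = fun x => gluedDeriv u' v' x + c * gluedDeriv f₁' f₂' x := by
  funext x
  simp only [gluedDeriv, reflDeriv, map_add, map_mul, Complex.conj_conj]
  ring

/-- **Cauchy–Schwarz in the split class under the glued slot:** for sign-admissible `b` with `GluedFormPSD b`, two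
designs on the same no-overlap split satisfy
`‖P^dict_b(g₁+R̃g₂, f₁+R̃f₂)‖² ≤ FormDetGlued_b(g₁,g₂)·FormDetGlued_b(f₁,f₂)`.
[cite: Zhang2022LandauSiegel, §2 (2.18)–(2.19), (2.32)–(2.33); §12 (12.6)–(12.8); §18 (18.1)] -/
theorem norm_sq_dictShiftPolar_glued_le (hb : ∀ j, b j ≠ 0) (hG : GluedFormPSD b)
    (ht : 0 ≤ t₁ ∧ 0 ≤ t₂ ∧ t₁ + t₂ ≤ 1) (hg : SidesAt t₁ t₂ g₁ g₁' g₂ g₂') (hf : SidesAt t₁ t₂ f₁ f₁' f₂ f₂') :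
    ‖DictShiftPolar b (gluedProfile g₁ g₂) (gluedDeriv g₁' g₂') (gluedProfile f₁ f₂) (gluedDeriv f₁' f₂')‖ ^ 2
      ≤ FormDetGlued b g₁ g₁' g₂ g₂' * FormDetGlued b f₁ f₁' f₂ f₂' := by
  rw [← (hg.gluedSides ht).dictShift_glued_eq_formDetGlued hb, ← (hf.gluedSides ht).dictShift_glued_eq_formDetGlued hb]
  refine norm_sq_dictPolar_le_of_line (isH1_gluedProfile hg.1 hg.2.1) (isH1_gluedProfile hf.1 hf.2.1)
    (fun c => ?_) ?_
  · have hs := (hg.add_smul hf c).gluedSides ht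
    have e := hs.dictShift_glued_eq_formDetGlued hb
    rw [gluedProfile_add_smul, gluedDeriv_add_smul] at e
    change 0 ≤ DictShift b _ _
    rw [e]
    exact hG _ _ _ _ hs
  · change 0 ≤ DictShift b _ _
    rw [(hf.gluedSides ht).dictShift_glued_eq_formDetGlued hb]
    exact hG _ _ _ _ (hf.gluedSides ht)

/-- the «T-true» shape in the split class under the glued slot:
`¬ (FormDetGlued_b(g₁,g₂)·FormDetGlued_b(f₁,f₂) < ‖P^dict_b(g₁+R̃g₂, f₁+R̃f₂)‖²)`.
[cite: Zhang2022LandauSiegel, §2 (2.18)–(2.19), (2.32)–(2.34)] -/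
theorem not_trueNeed_glued_of_psd (hb : ∀ j, b j ≠ 0) (hG : GluedFormPSD b)
    (ht : 0 ≤ t₁ ∧ 0 ≤ t₂ ∧ t₁ + t₂ ≤ 1) (hg : SidesAt t₁ t₂ g₁ g₁' g₂ g₂') (hf : SidesAt t₁ t₂ f₁ f₁' f₂ f₂') :
    ¬ (FormDetGlued b g₁ g₁' g₂ g₂' * FormDetGlued b f₁ f₁' f₂ f₂' <
        ‖DictShiftPolar b (gluedProfile g₁ g₂) (gluedDeriv g₁' g₂') (gluedProfile f₁ f₂) (gluedDeriv f₁' f₂')‖ ^ 2) :=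
  not_lt.2 (norm_sq_dictShiftPolar_glued_le hb hG ht hg hf)

end Det

namespace Repair

open Det

/-! ### Family B (the booked row): glued legs on a no-overlap split, `FormDetGlued` currency, slot `GluedFormPSD` -/

/-- **A design of the no-overlap glued shift-detector family**: a shift triple `b`, a split `(t₁, t₂)`, the two kinked
SIDES `g₁, g₂` of the `H`-side glued profile `𝔤 = g₁ + R̃g₂` and the two sides `f₁, f₂` of the probe's glued profile
`f₁ + R̃f₂`, with right-derivative companions. [cite: Zhang2022LandauSiegel, §2 (2.13), (2.27), (2.32); §12 (12.6)–(12.8)] -/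
structure DetGluedSepDesign : Type where
  /-- shift multiples `b = (b₀; b₁, b₂)` of the detector -/
  b : Fin 3 → ℝ
  /-- support length of side 1 -/
  t₁ : ℝ
  /-- support length of side 2 -/
  t₂ : ℝ
  /-- `H`-side, side 1 -/
  g₁ : ℝ → ℂ
  /-- its companion -/
  g₁' : ℝ → ℂ
  /-- `H`-side, side 2 (unreflected) -/
  g₂ : ℝ → ℂ
  /-- its companion -/
  g₂' : ℝ → ℂ
  /-- probe, side 1 -/
  f₁ : ℝ → ℂ
  /-- its companion -/
  f₁' : ℝ → ℂ
  /-- probe, side 2 (unreflected) -/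
  f₂ : ℝ → ℂ
  /-- its companion -/
  f₂' : ℝ → ℂ

namespace DetGluedSepDesign

/-- **Class membership** (no analytic hypothesis inside): `b` sign-admissible and in the Part-III box; a no-overlap split
`0 ≤ t₁, t₂`, `t₁ + t₂ ≤ 1`; both pairs of sides kinked on that split (`Det.SidesAt`).
[cite: Zhang2022LandauSiegel, §2 (2.13), Lemma 2.3; §12 (12.6)–(12.8)] -/
def InClass (d : DetGluedSepDesign) : Prop :=
  SignAdmissible d.b ∧ InShiftBox d.b ∧ (0 ≤ d.t₁ ∧ 0 ≤ d.t₂ ∧ d.t₁ + d.t₂ ≤ 1) ∧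
    SidesAt d.t₁ d.t₂ d.g₁ d.g₁' d.g₂ d.g₂' ∧ SidesAt d.t₁ d.t₂ d.f₁ d.f₁' d.f₂ d.f₂'

/-- **The verdict «no closing at main order», glued slot displayed**: IF `Det.GluedFormPSD b` THEN
`¬ (FormDetGlued_b(g₁,g₂)·FormDetGlued_b(f₁,f₂) < ‖P^dict_b(g₁+R̃g₂, f₁+R̃f₂)‖²)`.
[cite: Zhang2022LandauSiegel, §2 (2.18), Props. 2.4–2.6, (2.32)–(2.33); §18 (18.1)] -/
def Verdict (d : DetGluedSepDesign) : Prop :=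
  GluedFormPSD d.b →
    ¬ (FormDetGlued d.b d.g₁ d.g₁' d.g₂ d.g₂' * FormDetGlued d.b d.f₁ d.f₁' d.f₂ d.f₂' <
        ‖DictShiftPolar d.b (gluedProfile d.g₁ d.g₂) (gluedDeriv d.g₁' d.g₂')
            (gluedProfile d.f₁ d.f₂) (gluedDeriv d.f₁' d.f₂')‖ ^ 2)

end DetGluedSepDesign

/-- **NOT REPAIRABLE BY A SIGN-ADMISSIBLE SHIFT DETECTOR ON NO-OVERLAP GLUED LEGS (glued slot displayed).**
[cite: Zhang2022LandauSiegel, §2 (2.18), Props. 2.4–2.6, (2.32)–(2.33); §12 (12.6)–(12.8); §18 (18.1)] -/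
theorem not_repairable_detGluedSep : ∀ d : DetGluedSepDesign, d.InClass → d.Verdict :=
  fun _ ⟨hb, _, ht, hg, hf⟩ hG => not_trueNeed_glued_of_psd hb.ne_zero hG ht hg hf

/-- family «sign-admissible shift detector, no-overlap glued legs, FormDetGlued currency» (slot displayed in the
verdict, nothing conditional in the class). [cite: Zhang2022LandauSiegel, §2 Lemma 2.3, (2.32)–(2.33); §12 (12.6)–(12.8)] -/
def familyDetGluedSep : DesignFamily where
  Design := DetGluedSepDesign
  InClass := DetGluedSepDesign.InClass
  Verdict := DetGluedSepDesign.Verdict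

/-- `familyDetGluedSep` is decided. [cite: Zhang2022LandauSiegel, §2 (2.32)–(2.33)] -/
theorem familyDetGluedSep_decided : familyDetGluedSep.Decided := not_repairable_detGluedSep

/-- `R⁺ ++ [familyDetGluedSep]` is decided. [cite: Zhang2022LandauSiegel, §2 (2.32)–(2.33)] -/
theorem rplus_detGluedSep_decided : ClassDecided (Rplus ++ [familyDetGluedSep]) :=
  rplus_extend familyDetGluedSep_decided

/-- Under the slot discharged at the printed triple: every member with `b = (1,2,3)` satisfies the conclusion outright.
[cite: Zhang2022LandauSiegel, §4 (4.1); §2 (2.32)–(2.33)] -/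
theorem detGluedSep_unconditional_std (d : DetGluedSepDesign) (h : d.InClass) (hb : d.b = ![1, 2, 3]) :
    ¬ (FormDetGlued d.b d.g₁ d.g₁' d.g₂ d.g₂' * FormDetGlued d.b d.f₁ d.f₁' d.f₂ d.f₂' <
        ‖DictShiftPolar d.b (gluedProfile d.g₁ d.g₂) (gluedDeriv d.g₁' d.g₂')
            (gluedProfile d.f₁ d.f₂) (gluedDeriv d.f₁' d.f₂')‖ ^ 2) :=
  not_repairable_detGluedSep d h (hb ▸ gluedFormPSD_std)

/-! ### Family A (the full (u3) class): glued / overlapping / one-sided `H¹` legs, `DictShift` currency, slot `DictShiftPSD` -/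

namespace DetShiftDesign

/-- **Glued class membership** (no analytic hypothesis inside, NO apex condition): `b` sign-admissible in the Part-III box;
the `H`-leg `G` and the probe `f` are `H¹` profiles on `[0,1]` — glued two-sided profiles `g₁ + R̃g₂` with ANY overlap,
one-sided profiles, tents crossing the reflected side. [cite: Zhang2022LandauSiegel, §2 (2.13), Lemma 2.3, (2.18)–(2.19), (2.27)] -/
def InClassGlued (d : DetShiftDesign) : Prop :=
  SignAdmissible d.b ∧ InShiftBox d.b ∧ IsH1OnUnitInterval d.u d.u' ∧ IsH1OnUnitInterval d.f d.f'

/-- **The glued verdict, dictionary slot displayed**: IF `Det.DictShiftPSD b` THEN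
`¬ (DictShift_b(G)·DictShift_b(f) < ‖P^dict_b(G,f)‖²)`. [cite: Zhang2022LandauSiegel, §2 (2.18), Props. 2.4–2.6, (2.32)–(2.33); §4 (4.1)] -/
def VerdictGlued (d : DetShiftDesign) : Prop :=
  DictShiftPSD d.b →
    ¬ (DictShift d.b d.u d.u' * DictShift d.b d.f d.f' < ‖DictShiftPolar d.b d.u d.u' d.f d.f'‖ ^ 2)

end DetShiftDesign

/-- **NOT REPAIRABLE BY A SIGN-ADMISSIBLE SHIFT DETECTOR ON GLUED `H¹` LEGS (dictionary slot displayed):** positive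
semidefiniteness of `DictShift b` on `H¹`, its polarisation identity and the discriminant give exact Cauchy–Schwarz
(`Det.not_trueNeed_dict_of_psd`). [cite: Zhang2022LandauSiegel, §2 (2.18), Props. 2.4–2.6, (2.32)–(2.33); §4 (4.1)] -/
theorem not_repairable_detGlued : ∀ d : DetShiftDesign, d.InClassGlued → d.VerdictGlued :=
  fun _ ⟨_, _, hu, hf⟩ hpsd => not_trueNeed_dict_of_psd hpsd hu hf

/-- the threshold shape of the §2 final step on the glued class, under the slot.
[cite: Zhang2022LandauSiegel, §2 (2.18), Props. 2.4–2.6 p.6, (2.32)–(2.33)] -/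
theorem not_sqrt_closing_detGlued (d : DetShiftDesign) (h : d.InClassGlued) (hpsd : DictShiftPSD d.b)
    {q cJ dd : ℝ} (hq : DictShift d.b d.u d.u' ≤ q) (hcJ : DictShift d.b d.f d.f' ≤ cJ)
    (hd : dd ≤ ‖DictShiftPolar d.b d.u d.u' d.f d.f'‖) : ¬ (Real.sqrt (q * cJ) < dd) :=
  not_closing_dict_of_psd hpsd h.2.2.1 h.2.2.2 hq hcJ hd

/-- family «sign-admissible shift detector, glued `H¹` legs, DictShift currency» (slot displayed in the verdict).
[cite: Zhang2022LandauSiegel, §2 Lemma 2.3, (2.18)–(2.19), (2.32)–(2.33); §4 (4.1)] -/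
def familyDetGlued : DesignFamily where
  Design := DetShiftDesign
  InClass := DetShiftDesign.InClassGlued
  Verdict := DetShiftDesign.VerdictGlued

/-- `familyDetGlued` is decided. [cite: Zhang2022LandauSiegel, §2 (2.32)–(2.33)] -/
theorem familyDetGlued_decided : familyDetGlued.Decided := not_repairable_detGlued

/-- `R⁺ ++ [familyDetGlued]` is decided. [cite: Zhang2022LandauSiegel, §2 (2.32)–(2.33)] -/
theorem rplus_detGlued_decided : ClassDecided (Rplus ++ [familyDetGlued]) :=
  rplus_extend familyDetGlued_decided

/-- Both glued families at once: `R⁺ ++ [familyDetGluedSep, familyDetGlued]` is decided.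
[cite: Zhang2022LandauSiegel, §2 (2.32)–(2.33)] -/
theorem rplus_detGlued_both_decided : ClassDecided (Rplus ++ [familyDetGluedSep, familyDetGlued]) :=
  classDecided_append.2 ⟨rplus_decided,
    classDecided_cons familyDetGluedSep_decided (classDecided_cons familyDetGlued_decided classDecided_nil)⟩

/-! ### Row 17 embeds: one-sided members are glued members, and the glued verdict restricts to theirs -/

/-- A row-17 member (one-sided kinked legs) is a glued member (kinked ⇒ `H¹`). [cite: Zhang2022LandauSiegel, §7 (7.2) p.44] -/
theorem inClassGlued_of_inClass (d : DetShiftDesign) (h : d.InClass) : d.InClassGlued :=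
  ⟨h.1, h.2.1, h.2.2.1.isH1, h.2.2.2.2.1.isH1⟩

/-- On one-sided kinked legs the glued verdict's three functionals ARE row 17's (`dictShift_eq_formDet`,
`dictShiftPolar_eq_formDetPolar`), so the glued verdict reads `DictShiftPSD b → ¬ (𝔅_b(u)·𝔅_b(f) < ‖P_b(u,f)‖²)`.
[cite: Zhang2022LandauSiegel, Prop 7.1 pp.44–50; §2 (2.32)–(2.33)] -/
theorem detGlued_verdict_iff_oneSided (d : DetShiftDesign) (h : d.InClass) :
    d.VerdictGlued ↔ (DictShiftPSD d.b →
      ¬ (FormDet (shiftRecipe d.b) d.u d.u' * FormDet (shiftRecipe d.b) d.f d.f'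
          < ‖FormDetPolar (shiftRecipe d.b) d.u d.u' d.f d.f'‖ ^ 2)) := by
  obtain ⟨-, -, hu, hu1, hf, hf1⟩ := h
  simp only [DetShiftDesign.VerdictGlued, dictShift_eq_formDet _ hu hu1, dictShift_eq_formDet _ hf hf1,
    dictShiftPolar_eq_formDetPolar _ hu hf hu1 hf1]

/-- … and the glued slot implies row 17's slot, so row 17's verdict follows from membership alone under `DictShiftPSD`.
[cite: Zhang2022LandauSiegel, Prop 7.1 pp.44–50; §2 (2.32)–(2.33)] -/
theorem detShift_conclusion_of_dictShiftPSD (d : DetShiftDesign) (h : d.InClass) (hpsd : DictShiftPSD d.b) :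
    ¬ (FormDet (shiftRecipe d.b) d.u d.u' * FormDet (shiftRecipe d.b) d.f d.f'
        < ‖FormDetPolar (shiftRecipe d.b) d.u d.u' d.f d.f'‖ ^ 2) :=
  not_repairable_detShift d h hpsd.formDetPSD

/-! ### C2: at the printed triple the slots are discharged and the glued verdict is `familyH1`'s / row 1's -/

section Std

variable {u u' f f' : ℝ → ℂ}

/-- **C2.** At `b = (1,2,3)` the glued verdict on `H¹` legs is LITERALLY `familyH1`'s profile-level verdict
`¬ (𝔅(u)·𝔅(f) < ‖P(u,f)‖²)` (`dictShift_std`, `dictShiftPolar_std`) — and holds (slot `dictShiftPSD_std`).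
[cite: Zhang2022LandauSiegel, §4 (4.1); §2 (2.18), (2.32)–(2.33)] -/
theorem detGlued_std_verdict_iff (u u' f f' : ℝ → ℂ) :
    (⟨![1, 2, 3], u, u', f, f'⟩ : DetShiftDesign).VerdictGlued ↔
      ¬ (mainTermForm u u' * mainTermForm f f' < ‖mainTermFormPolar u u' f f'‖ ^ 2) := by
  simp only [DetShiftDesign.VerdictGlued, dictShift_std, dictShiftPolar_std]
  exact ⟨fun h => h dictShiftPSD_std, fun h _ => h⟩

/-- **C2 at family level**: a glued member with `b = (1,2,3)` is a `familyH1` member with the same verdict, and the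
verdict's conclusion holds outright. [cite: Zhang2022LandauSiegel, §4 (4.1); §2 (2.18), (2.32)–(2.33)] -/
theorem detGlued_std_toH1 (d : DetShiftDesign) (h : d.InClassGlued) (hb : d.b = ![1, 2, 3]) :
    familyH1.InClass (d.u, d.u', d.f, d.f') ∧ (d.VerdictGlued ↔ familyH1.Verdict (d.u, d.u', d.f, d.f')) ∧
      familyH1.Verdict (d.u, d.u', d.f, d.f') := by
  obtain ⟨b, u, u', f, f'⟩ := d
  obtain ⟨-, -, hu, hf⟩ := h
  simp only at hb hu hf
  subst hb
  exact ⟨⟨hu, hf⟩, detGlued_std_verdict_iff u u' f f', not_repairable_in_Rplus (.hOne u u' f f') ⟨hu, hf⟩⟩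

end Std

/-! ### C4: the GENUINE glued design legs `(𝔤_θ, f_θ)` of every calculus-class `θ` are members, for every
admissible detector; at `b = (1,2,3)` the verdict is row 1's `¬ (C₂₃₂S·C₂₃₃T < |𝔡+𝔡′|²)` -/

section Legs

variable {θ : Theta} {b : Fin 3 → ℝ}

/-- **The glued design legs under detector `b`**: `(G, f) = (𝔤_θ, f_θ) = (gluedS θ, tentT θ)` — the manuscript's
two-sided `H`-profile `g₁ + R̃g₂` (overlap `[1−ν₂, ν₁]` included) against its tent probe.
[cite: Zhang2022LandauSiegel, §2 (2.23)–(2.28), (2.32); §10 (10.1)] -/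
def gluedLeg (b : Fin 3 → ℝ) (θ : Theta) : DetShiftDesign :=
  ⟨b, gluedS θ, gluedS' θ, tentT θ, tentT' θ⟩

/-- **C4 (members)**: the glued design legs of every calculus-class `θ` are in `familyDetGlued` for every admissible `b`
(`glued_isH1_on_calc`, `tent_isH1_on_calc`). [cite: Zhang2022LandauSiegel, §2 (2.23)–(2.28); §10 (10.1)] -/
theorem inClass_gluedLeg (hb : SignAdmissible b ∧ InShiftBox b) (hθ : AdmissibleThetaCalc θ) :
    (gluedLeg b θ).InClassGlued :=
  ⟨hb.1, hb.2, glued_isH1_on_calc θ hθ, tent_isH1_on_calc θ hθ⟩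

/-- **The glued family's verdict at `((1,2,3), θ)` IS row 1's verdict** `¬ (C₂₃₂S θ·C₂₃₃T θ < ‖dSumS θ‖²)` for every
calculus-class `θ` (`h232_on_calc`, `h233_on_calc`, `hsum_on_calc`: the dictionary identities K-S1–K-S3 of the record).
[cite: Zhang2022LandauSiegel, §2 (2.32)–(2.33); §10 (10.1), (10.17); §18 (18.1)] -/
theorem detGlued_std_gluedLeg_verdict_iff (hθ : AdmissibleThetaCalc θ) :
    (gluedLeg ![1, 2, 3] θ).VerdictGlued ↔ ¬ (C232S θ * C233T θ < ‖dSumS θ‖ ^ 2) := by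
  rw [gluedLeg, detGlued_std_verdict_iff, ← h232_on_calc θ hθ, ← h233_on_calc θ hθ, ← hsum_on_calc θ hθ]

/-- … hence the glued family re-derives `Repair.not_repairable_true_need_calc` (row 6 / row 1 on `R`): for every
calculus-class `θ`, `¬ (C₂₃₂S·C₂₃₃T < |𝔡+𝔡′|²)`. [cite: Zhang2022LandauSiegel, §2 (2.32)–(2.33); §10 (10.1)] -/
theorem detGlued_std_gluedLeg_verdict (hθ : AdmissibleThetaCalc θ) :
    ¬ (C232S θ * C233T θ < ‖dSumS θ‖ ^ 2) := by
  have h : (gluedLeg ![1, 2, 3] θ).VerdictGlued :=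
    not_repairable_detGlued (gluedLeg ![1, 2, 3] θ) (inClass_gluedLeg ⟨signAdmissible_std, inShiftBox_std⟩ hθ)
  exact (detGlued_std_gluedLeg_verdict_iff hθ).1 h

/-- **The glued family's verdict at `(b, θ)` for a general admissible detector, slot displayed:**
`DictShiftPSD b → ¬ (DictShift_b(𝔤_θ)·DictShift_b(f_θ) < ‖P^dict_b(𝔤_θ, f_θ)‖²)`.
[cite: Zhang2022LandauSiegel, §2 (2.32)–(2.33); §4 (4.1); §10 (10.1)] -/
theorem detGlued_gluedLeg_verdict (hb : SignAdmissible b ∧ InShiftBox b) (hθ : AdmissibleThetaCalc θ)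
    (hpsd : DictShiftPSD b) :
    ¬ (DictShift b (gluedS θ) (gluedS' θ) * DictShift b (tentT θ) (tentT' θ)
        < ‖DictShiftPolar b (gluedS θ) (gluedS' θ) (tentT θ) (tentT' θ)‖ ^ 2) :=
  not_repairable_detGlued (gluedLeg b θ) (inClass_gluedLeg hb hθ) hpsd

/-- **C4 (named members)**: at the printed design `θ₀` the glued legs are members for the three admissible shift boxes
`(1;2,3)` (slot discharged), `bOffLattice`, `bNearLattice` (slot displayed). [cite: Zhang2022LandauSiegel, §2 (2.13), (2.21)–(2.28)] -/
theorem inClass_gluedLeg_theta0 :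
    (gluedLeg ![1, 2, 3] theta0).InClassGlued ∧ (gluedLeg bOffLattice theta0).InClassGlued ∧
      (gluedLeg bNearLattice theta0).InClassGlued :=
  ⟨inClass_gluedLeg ⟨signAdmissible_std, inShiftBox_std⟩ admissible_theta0.toCalc,
    inClass_gluedLeg signAdmissible_bOffLattice admissible_theta0.toCalc,
    inClass_gluedLeg signAdmissible_bNearLattice admissible_theta0.toCalc⟩

end Legs

end Repair

end Literature.NumberTheory.LFunctions.Zhang2022
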